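import Mathlib
import Summits.NavierStokesRegularity.NavierStokesRegularity.Theorems.TaoLadderRungThreeGappedFrontRobustSelection
import Summits.NavierStokesRegularity.NavierStokesRegularity.Theorems.TaoLadderRungThreeGappedFrontRobustEnvelope
import HarnessLib

/-!
# `GappedFrontRobust`, the (step) clause: selection of the TOP SHELL of the front block / the start of
  the tail (memo §10 steps (2), (6); helper for item stmt-NavierStokesRegularity-22114 `GappedFrontRobustV2`)

HONEST FRAMING: an elementary real-number lemma combining `rpow_le_mul_weight_of_T1` (`…Envelope`) with
`exists_rpow_neg_mul_le_atTop` (`…Selection`); nothing is asserted about any table or flow; nothing here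
concerns the Navier–Stokes equations. `exists_top_shell`: under (T1) from `k₁` (`q > 1`, `w > 0`), for every
`ε > 0` there is `kt ≥ max k₁ 1` with `q^{5k/2} / w k ≤ ε` for all `k ≥ kt` — the top-flux smallness of
`pseudoFlowOn_block_and_behind` and the "top forcing → 0" of the active zone.
-/

noncomputable section

-- the sub-problem namespace `Summit.NavierStokesRegularity.NavierStokesRegularity` repeats the summit name by design (D-0017)
set_option linter.dupNamespace false

namespace Summit.NavierStokesRegularity.NavierStokesRegularity.Theorems

open Set Literature.Analysis.FluidPDE Literature.Analysis.FluidPDE.TaoCascade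

namespace GappedFrontRobust

/-- **Selection of the top shell of the front block / the start of the tail** (memo §10 (2), (6)): under (T1)
from `k₁` (`q > 1`, `w > 0`), for every `ε > 0` there is `kt ≥ max k₁ 1` with `q^{5k/2} / w k ≤ ε` for ALL
`k ≥ kt` (the weights dominate `q^{7k/2}`, `rpow_le_mul_weight_of_T1`, and `q^{−k} → 0`). [folklore] -/
theorem exists_top_shell {q : ℝ} {w : ℤ → ℝ} {k₁ : ℤ} (hq : 1 < q) (hw : ∀ k, 0 < w k)
    (hT1 : ∀ k : ℤ, k₁ ≤ k → 2 * q ^ (k : ℝ) * w k ≤ w (k + 1)) {ε : ℝ} (hε : 0 < ε) :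
    ∃ kt : ℤ, k₁ ≤ kt ∧ 1 ≤ kt ∧ ∀ k : ℤ, kt ≤ k → q ^ ((5 : ℝ) * k / 2) / w k ≤ ε := by
  have hq0 : 0 < q := by linarith
  obtain ⟨J, A, hA, hJA⟩ := rpow_le_mul_weight_of_T1 hq.le hw hT1 ((7 : ℝ) / 2)
  obtain ⟨N, hN⟩ := exists_rpow_neg_mul_le_atTop hq one_pos (div_pos hε hA)
  refine ⟨max (max J N) (max k₁ 1), le_trans (le_max_left _ _) (le_max_right _ _),
    le_trans (le_max_right _ _) (le_max_right _ _), fun k hk => ?_⟩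
  have hkJ : J ≤ k := le_trans (le_trans (le_max_left _ _) (le_max_left _ _)) hk
  have hkN : N ≤ k := le_trans (le_trans (le_max_right _ _) (le_max_left _ _)) hk
  have h1 := hJA k hkJ
  have h2 := hN k hkN
  have hwk := hw k
  -- q^{5k/2} / w k = q^{7k/2} q^{-k} / w k ≤ A q^{-k}
  rw [div_le_iff₀ hwk]
  have hsplit : q ^ ((5 : ℝ) * k / 2) = q ^ ((7 : ℝ) / 2 * k) * q ^ (-((1 : ℝ) * k)) := by
    rw [← Real.rpow_add hq0]; ring_nf
  rw [hsplit]
  have hqn : 0 ≤ q ^ (-((1 : ℝ) * k)) := (Real.rpow_pos_of_pos hq0 _).le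
  calc q ^ ((7 : ℝ) / 2 * k) * q ^ (-((1 : ℝ) * k)) ≤ (A * w k) * q ^ (-((1 : ℝ) * k)) :=
        mul_le_mul_of_nonneg_right h1 hqn
    _ = (A * q ^ (-((1 : ℝ) * k))) * w k := by ring
    _ ≤ (A * (ε / A)) * w k := by
        refine mul_le_mul_of_nonneg_right (mul_le_mul_of_nonneg_left h2 hA.le) hwk.le
    _ = ε * w k := by field_simp

end GappedFrontRobust

end Summit.NavierStokesRegularity.NavierStokesRegularity.Theorems

end
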